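import Summits.HubbardSuperconductivity.HubbardSuperconductivity.Theorems.AnisotropyChordTransferFibre3FamilyATrapezoid
import Summits.HubbardSuperconductivity.HubbardSuperconductivity.Theorems.AnisotropyChordTransferFibre3FamilyAPsiConvex
import Summits.HubbardSuperconductivity.HubbardSuperconductivity.Theorems.AnisotropyChordTransferFibre3FamilyAPsiZero

/-!
# Route `AnisotropyChord` / H0 rotor rung: the trapezoidal (Euler–Maclaurin) evaluation of the capacity row sum (family A, LEMMA A0 step 2)

The far rows of the exact row form of the torus capacity (`…Fibre3GreenZeroRowForm`: `G̃₀(0) = (1−1/L²)/12 + (1/L)Σ_p (1+b_p)ψ₀(2πp/L)`)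
are a trapezoidal sum of the CONVEX profile `ψ₀ = psiRow 0` (`psiConvex_holds`), so the one-sided Euler–Maclaurin lemma
`trapezoidConvex_holds` and the closed-form primitive `psiZeroPrimitive_of_lt_pi` evaluate them:

★ `farRows_trapezoid`: for `1 ≤ a`, `2a < L`, with `s = sin(πa/L)`, `c = cos(πa/L)`, `P = s²(1+s²)`:
  `0 ≤ Σ_{m=a}^{L−a} ψ₀(2πm/L) − (L/4π)·log((1+√(1−s⁴))/s²) − ψ₀(2πa/L) ≤ (π/(2L))·s c(1+2s²)/(8P√P)`.
Ingredients proved here: the derivative of `ψ₀` (`hasDerivAt_psiRow_zero`), its continuity, the reflection symmetries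
`ψ₀(2π−u) = ψ₀(u)`, `ψ₀'(2π−u) = −ψ₀'(u)`, convexity of `m ↦ ψ₀(2πm/L)` on `[a, L−a]`, and the integral
`∫_{u}^{2π−u} ψ₀ = ½·log((1+√(1−s⁴))/s²)` (FTC on `[u, π]` + reflection).
Prover seat `hubbard-h0-rotor-p1` g26; helper for stmt-HubbardSuperconductivity-19089 (`--supports`, helper class).
WHAT THIS IS NOT: nothing here proves superconductivity in the Hubbard model; generic real analysis feeding ONE input (the capacity
constant) of ONE conditional reduction (rung 19089).  Tree imports only; no new definitions; no sorry, no axioms.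
-/

set_option linter.dupNamespace false
set_option autoImplicit false

noncomputable section

open scoped BigOperators
open Real Finset MeasureTheory intervalIntegral

namespace Summit.HubbardSuperconductivity.HubbardSuperconductivity.Theorems.AnisotropyChord.Transfer.Fibre3

namespace CapacityConst

/-! ## `ψ₀` in product form, its symmetry, its derivative -/

/-- `psiRow 0` unfolded: `1/(4√(sin²(k/2)(1 + sin²(k/2))))`. [folklore] -/
theorem psiRow_zero_def (k : ℝ) :
    psiRow 0 k = 1 / (4 * Real.sqrt (Real.sin (k / 2) ^ 2 * (1 + Real.sin (k / 2) ^ 2))) := by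
  unfold psiRow; rw [sub_zero, sub_zero]

/-- reflection: `ψ₀(2π − k) = ψ₀(k)`. [folklore] -/
theorem psiRow_zero_reflect (k : ℝ) : psiRow 0 (2 * Real.pi - k) = psiRow 0 k := by
  rw [psiRow_zero_def, psiRow_zero_def,
    show (2 * Real.pi - k) / 2 = Real.pi - k / 2 by ring, Real.sin_pi_sub]

/-- the derivative profile `ψ₀'(k) = −s c (1 + 2s²)/(8 P √P)`, `s = sin(k/2)`, `c = cos(k/2)`, `P = s²(1+s²)` (inlined). [folklore] -/
theorem hasDerivAt_psiRow_zero (k : ℝ) (hk0 : 0 < k) (hk2 : k < 2 * Real.pi) :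
    HasDerivAt (psiRow 0)
      (-(Real.sin (k / 2) * Real.cos (k / 2) * (1 + 2 * Real.sin (k / 2) ^ 2))
        / (8 * (Real.sin (k / 2) ^ 2 * (1 + Real.sin (k / 2) ^ 2))
            * Real.sqrt (Real.sin (k / 2) ^ 2 * (1 + Real.sin (k / 2) ^ 2)))) k := by
  have hfun : psiRow 0 = fun k => 1 / (4 * Real.sqrt (Real.sin (k / 2) ^ 2 * (1 + Real.sin (k / 2) ^ 2))) := by
    funext k; exact psiRow_zero_def k
  rw [hfun]
  set s := Real.sin (k / 2) with hs
  set c := Real.cos (k / 2) with hc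
  have hs0 : 0 < s := Real.sin_pos_of_pos_of_lt_pi (by linarith) (by linarith)
  have hP : 0 < s ^ 2 * (1 + s ^ 2) := by positivity
  -- derivative of `k ↦ sin(k/2)`
  have h1 : HasDerivAt (fun k => Real.sin (k / 2)) (Real.cos (k / 2) * (1 / 2)) k :=
    ((hasDerivAt_id k).div_const 2).sin
  -- derivative of `P(k) = sin²(k/2)(1 + sin²(k/2))` via the polynomial `q(s) = s²(1+s²)`
  have hq : HasDerivAt (fun s : ℝ => s ^ 2 * (1 + s ^ 2)) (2 * s * (1 + s ^ 2) + s ^ 2 * (2 * s)) s := by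
    have hp2 : HasDerivAt (fun s : ℝ => s ^ 2) (2 * s) s := by
      simpa using hasDerivAt_pow 2 s
    exact hp2.mul (hp2.const_add 1)
  have h2 : HasDerivAt (fun k => Real.sin (k / 2) ^ 2 * (1 + Real.sin (k / 2) ^ 2))
      (s * c * (1 + 2 * s ^ 2)) k := by
    have := hq.comp k h1
    refine (this.congr_deriv ?_)
    rw [← hc]
    ring
  -- square root and reciprocal
  have hsq0 : 0 < Real.sqrt (s ^ 2 * (1 + s ^ 2)) := Real.sqrt_pos.mpr hP
  have h3 : HasDerivAt (fun k => Real.sqrt (Real.sin (k / 2) ^ 2 * (1 + Real.sin (k / 2) ^ 2)))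
      (s * c * (1 + 2 * s ^ 2) / (2 * Real.sqrt (s ^ 2 * (1 + s ^ 2)))) k := h2.sqrt hP.ne'
  have h4 : HasDerivAt (fun k => 4 * Real.sqrt (Real.sin (k / 2) ^ 2 * (1 + Real.sin (k / 2) ^ 2)))
      (4 * (s * c * (1 + 2 * s ^ 2) / (2 * Real.sqrt (s ^ 2 * (1 + s ^ 2))))) k := h3.const_mul 4
  have h4ne : (4 * Real.sqrt (Real.sin (k / 2) ^ 2 * (1 + Real.sin (k / 2) ^ 2))) ≠ 0 := by
    rw [← hs]; positivity
  have h5 := (hasDerivAt_const k (1 : ℝ)).div h4 h4ne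
  refine h5.congr_deriv ?_
  rw [← hs]
  set t := Real.sqrt (s ^ 2 * (1 + s ^ 2)) with ht
  have ht2 : t ^ 2 = s ^ 2 * (1 + s ^ 2) := Real.sq_sqrt hP.le
  have ht0 : 0 < t := hsq0
  rw [mul_pow, ht2]
  field_simp
  ring

/-- the derivative profile is odd under reflection: at `2π − k` it is the negative of its value at `k`. [folklore] -/
theorem deriv_profile_reflect (k : ℝ) :
    (-(Real.sin ((2 * Real.pi - k) / 2) * Real.cos ((2 * Real.pi - k) / 2) * (1 + 2 * Real.sin ((2 * Real.pi - k) / 2) ^ 2))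
        / (8 * (Real.sin ((2 * Real.pi - k) / 2) ^ 2 * (1 + Real.sin ((2 * Real.pi - k) / 2) ^ 2))
            * Real.sqrt (Real.sin ((2 * Real.pi - k) / 2) ^ 2 * (1 + Real.sin ((2 * Real.pi - k) / 2) ^ 2))))
      = -(-(Real.sin (k / 2) * Real.cos (k / 2) * (1 + 2 * Real.sin (k / 2) ^ 2))
        / (8 * (Real.sin (k / 2) ^ 2 * (1 + Real.sin (k / 2) ^ 2))
            * Real.sqrt (Real.sin (k / 2) ^ 2 * (1 + Real.sin (k / 2) ^ 2)))) := by
  rw [show (2 * Real.pi - k) / 2 = Real.pi - k / 2 by ring, Real.sin_pi_sub, Real.cos_pi_sub]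
  ring

/-! ## The integral `∫_u^{2π−u} ψ₀ = ½ log((1 + √(1 − s⁴))/s²)` -/

/-- continuity of `ψ₀` on `[u, 2π − u]` for `0 < u`. [folklore] -/
theorem continuousOn_psiRow_zero (u : ℝ) (hu : 0 < u) :
    ContinuousOn (psiRow 0) (Set.Icc u (2 * Real.pi - u)) := by
  intro k hk
  have hk0 : 0 < k := by linarith [hk.1]
  have hk2 : k < 2 * Real.pi := by linarith [hk.2]
  exact (hasDerivAt_psiRow_zero k hk0 hk2).continuousAt.continuousWithinAt

/-- ★ `∫_u^{π} ψ₀ = ¼ log((1 + √(1 − s⁴))/s²)`, `s = sin(u/2)`, for `0 < u ≤ π` (FTC with `psiZeroPrimitive_of_lt_pi`). [folklore] -/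
theorem integral_psiRow_zero_half (u : ℝ) (hu : 0 < u) (huπ : u ≤ Real.pi) :
    ∫ k in u..Real.pi, psiRow 0 k
      = (1 / 4) * Real.log ((1 + Real.sqrt (1 - Real.sin (u / 2) ^ 4)) / Real.sin (u / 2) ^ 2) := by
  set F : ℝ → ℝ := fun k =>
    -(1 / 4 : ℝ) * Real.log ((1 + Real.sqrt (1 - Real.sin (k / 2) ^ 4)) / Real.sin (k / 2) ^ 2) with hF
  have hπ := Real.pi_pos
  -- `F` is continuous on `[u, π]` (the argument of `log` is positive there)
  have hsin_pos : ∀ k ∈ Set.Icc u Real.pi, 0 < Real.sin (k / 2) := by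
    intro k hk
    exact Real.sin_pos_of_pos_of_lt_pi (by linarith [hk.1]) (by linarith [hk.2])
  have hcontF : ContinuousOn F (Set.Icc u Real.pi) := by
    have harg : ContinuousOn (fun k => (1 + Real.sqrt (1 - Real.sin (k / 2) ^ 4)) / Real.sin (k / 2) ^ 2)
        (Set.Icc u Real.pi) := by
      apply ContinuousOn.div
      · exact (continuous_const.add ((continuous_const.sub
          ((Real.continuous_sin.comp (continuous_id.div_const 2)).pow 4)).sqrt)).continuousOn
      · exact ((Real.continuous_sin.comp (continuous_id.div_const 2)).pow 2).continuousOn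
      · intro k hk; exact (pow_pos (hsin_pos k hk) 2).ne'
    refine ContinuousOn.mul continuousOn_const (harg.log ?_)
    intro k hk
    have h1 := hsin_pos k hk
    have h2 : 0 ≤ Real.sqrt (1 - Real.sin (k / 2) ^ 4) := Real.sqrt_nonneg _
    exact (div_pos (by linarith) (pow_pos h1 2)).ne'
  have hderiv : ∀ k ∈ Set.Ioo u Real.pi,
      HasDerivAt F (1 / (4 * Real.sin (k / 2) * Real.sqrt (1 + Real.sin (k / 2) ^ 2))) k := by
    intro k hk
    exact psiZeroPrimitive_of_lt_pi k (by linarith [hk.1]) hk.2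
  -- the integrand of the primitive equals `ψ₀` on `[u, π]`
  have hcongr : ∀ k ∈ Set.uIcc u Real.pi,
      psiRow 0 k = 1 / (4 * Real.sin (k / 2) * Real.sqrt (1 + Real.sin (k / 2) ^ 2)) := by
    intro k hk
    rw [Set.uIcc_of_le huπ] at hk
    rw [psiRow_zero_def, Real.sqrt_mul (sq_nonneg _), Real.sqrt_sq (hsin_pos k hk).le]
    ring
  rw [intervalIntegral.integral_congr hcongr]
  have hint : IntervalIntegrable (fun k => 1 / (4 * Real.sin (k / 2) * Real.sqrt (1 + Real.sin (k / 2) ^ 2)))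
      volume u Real.pi := by
    apply ContinuousOn.intervalIntegrable
    rw [Set.uIcc_of_le huπ]
    apply ContinuousOn.div continuousOn_const
    · exact ((continuous_const.mul (Real.continuous_sin.comp (continuous_id.div_const 2))).mul
        ((continuous_const.add ((Real.continuous_sin.comp (continuous_id.div_const 2)).pow 2)).sqrt)).continuousOn
    · intro k hk
      have h1 := hsin_pos k hk
      have : 0 < Real.sqrt (1 + Real.sin (k / 2) ^ 2) := Real.sqrt_pos.mpr (by positivity)
      positivity
  rw [intervalIntegral.integral_eq_sub_of_hasDerivAt_of_le huπ hcontF hderiv hint]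
  simp only [hF]
  rw [show Real.pi / 2 = Real.pi / 2 from rfl, Real.sin_pi_div_two]
  norm_num

/-- ★ the symmetric integral: `∫_u^{2π−u} ψ₀ = ½ log((1 + √(1 − s⁴))/s²)` for `0 < u ≤ π`. [folklore] -/
theorem integral_psiRow_zero_symm (u : ℝ) (hu : 0 < u) (huπ : u ≤ Real.pi) :
    ∫ k in u..(2 * Real.pi - u), psiRow 0 k
      = (1 / 2) * Real.log ((1 + Real.sqrt (1 - Real.sin (u / 2) ^ 4)) / Real.sin (u / 2) ^ 2) := by
  have hcont := continuousOn_psiRow_zero u hu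
  have hi1 : IntervalIntegrable (psiRow 0) volume u Real.pi := by
    apply ContinuousOn.intervalIntegrable
    rw [Set.uIcc_of_le huπ]
    exact hcont.mono (Set.Icc_subset_Icc le_rfl (by linarith))
  have hi2 : IntervalIntegrable (psiRow 0) volume Real.pi (2 * Real.pi - u) := by
    apply ContinuousOn.intervalIntegrable
    rw [Set.uIcc_of_le (by linarith)]
    exact hcont.mono (Set.Icc_subset_Icc (by linarith) le_rfl)
  rw [← intervalIntegral.integral_add_adjacent_intervals hi1 hi2]
  -- the second half equals the first by reflection
  have hrefl : ∫ k in Real.pi..(2 * Real.pi - u), psiRow 0 k = ∫ k in u..Real.pi, psiRow 0 k := by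
    have h := intervalIntegral.integral_comp_sub_left (fun k => psiRow 0 k) (2 * Real.pi) (a := u) (b := Real.pi)
    rw [show 2 * Real.pi - Real.pi = Real.pi by ring] at h
    rw [← h]
    refine intervalIntegral.integral_congr (fun k _ => ?_)
    exact psiRow_zero_reflect k
  rw [hrefl, integral_psiRow_zero_half u hu huπ]
  ring

/-! ## ★ The trapezoidal evaluation of the far rows -/

/-- ★ FAR ROWS BY THE ONE-SIDED TRAPEZOIDAL RULE: for `1 ≤ a`, `2a < L`, `s = sin(πa/L)`, `c = cos(πa/L)`, `P = s²(1+s²)`: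
`0 ≤ Σ_{m=a}^{L−a} ψ₀(2πm/L) − (L/4π) log((1+√(1−s⁴))/s²) − ψ₀(2πa/L) ≤ (π/(2L))·(s c (1+2s²))/(8 P √P)`. [folklore] -/
theorem farRows_trapezoid (L a : ℕ) (ha : 1 ≤ a) (haL : 2 * a < L) :
    0 ≤ (∑ m ∈ Finset.Icc (a : ℤ) ((L : ℤ) - a), psiRow 0 (2 * Real.pi * (m : ℝ) / L))
        - (L : ℝ) / (4 * Real.pi) * Real.log ((1 + Real.sqrt (1 - Real.sin (Real.pi * a / L) ^ 4))
            / Real.sin (Real.pi * a / L) ^ 2)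
        - psiRow 0 (2 * Real.pi * a / L) ∧
      (∑ m ∈ Finset.Icc (a : ℤ) ((L : ℤ) - a), psiRow 0 (2 * Real.pi * (m : ℝ) / L))
        - (L : ℝ) / (4 * Real.pi) * Real.log ((1 + Real.sqrt (1 - Real.sin (Real.pi * a / L) ^ 4))
            / Real.sin (Real.pi * a / L) ^ 2)
        - psiRow 0 (2 * Real.pi * a / L)
        ≤ Real.pi / (2 * L) * ((Real.sin (Real.pi * a / L) * Real.cos (Real.pi * a / L)
              * (1 + 2 * Real.sin (Real.pi * a / L) ^ 2))
            / (8 * (Real.sin (Real.pi * a / L) ^ 2 * (1 + Real.sin (Real.pi * a / L) ^ 2))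
              * Real.sqrt (Real.sin (Real.pi * a / L) ^ 2 * (1 + Real.sin (Real.pi * a / L) ^ 2)))) := by
  have hπ := Real.pi_pos
  have hL0 : (0 : ℝ) < L := by exact_mod_cast (show 0 < L by omega)
  have haR : (1 : ℝ) ≤ a := by exact_mod_cast ha
  have haLR : 2 * (a : ℝ) < L := by exact_mod_cast haL
  set cL : ℝ := 2 * Real.pi / L with hcL
  have hcL0 : 0 < cL := by positivity
  -- the summand as a function of a real variable and its derivative
  set f : ℝ → ℝ := fun x => psiRow 0 (cL * x) with hf
  set g : ℝ → ℝ := fun k =>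
    -(Real.sin (k / 2) * Real.cos (k / 2) * (1 + 2 * Real.sin (k / 2) ^ 2))
      / (8 * (Real.sin (k / 2) ^ 2 * (1 + Real.sin (k / 2) ^ 2))
          * Real.sqrt (Real.sin (k / 2) ^ 2 * (1 + Real.sin (k / 2) ^ 2))) with hg
  set f' : ℝ → ℝ := fun x => cL * g (cL * x) with hf'
  -- the interval `[a, L−a]` is mapped into `(0, 2π)`
  have hrange : ∀ x ∈ Set.Icc (a : ℝ) ((L : ℝ) - a), 0 < cL * x ∧ cL * x < 2 * Real.pi := by
    intro x hx
    have hx0 : 0 < x := by linarith [hx.1]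
    refine ⟨mul_pos hcL0 hx0, ?_⟩
    rw [hcL]
    have hx2 : x ≤ (L : ℝ) - a := hx.2
    have : 2 * Real.pi / L * x ≤ 2 * Real.pi / L * ((L : ℝ) - a) :=
      mul_le_mul_of_nonneg_left hx2 (by positivity)
    have h2 : 2 * Real.pi / L * ((L : ℝ) - a) < 2 * Real.pi := by
      rw [div_mul_eq_mul_div, div_lt_iff₀ hL0]; nlinarith
    linarith
  have hderiv : ∀ x ∈ Set.Icc (a : ℝ) ((L : ℝ) - a), HasDerivAt f (f' x) x := by
    intro x hx
    obtain ⟨h0, h2⟩ := hrange x hx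
    have h := hasDerivAt_psiRow_zero (cL * x) h0 h2
    have hlin : HasDerivAt (fun x : ℝ => cL * x) cL x := by
      simpa using (hasDerivAt_id x).const_mul cL
    refine ((h.comp x hlin).congr_deriv ?_)
    simp only [hf', hg]
    ring
  have hcont' : ContinuousOn f' (Set.Icc (a : ℝ) ((L : ℝ) - a)) := by
    simp only [hf', hg]
    apply ContinuousOn.mul continuousOn_const
    have hs_ne : ∀ x ∈ Set.Icc (a : ℝ) ((L : ℝ) - a), Real.sin (cL * x / 2) ≠ 0 := by
      intro x hx
      obtain ⟨h0, h2⟩ := hrange x hx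
      exact (Real.sin_pos_of_pos_of_lt_pi (by linarith) (by linarith)).ne'
    apply ContinuousOn.div
    · apply Continuous.continuousOn
      fun_prop
    · apply ContinuousOn.mul
      · apply Continuous.continuousOn; fun_prop
      · apply Continuous.continuousOn; fun_prop
    · intro x hx
      have h1 := hs_ne x hx
      have hP : 0 < Real.sin (cL * x / 2) ^ 2 * (1 + Real.sin (cL * x / 2) ^ 2) := by positivity
      have : 0 < Real.sqrt (Real.sin (cL * x / 2) ^ 2 * (1 + Real.sin (cL * x / 2) ^ 2)) :=
        Real.sqrt_pos.mpr hP
      positivity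
  -- convexity of `f` on `[a, L−a]` from `PsiConvex`
  have hconv : ConvexOn ℝ (Set.Icc (a : ℝ) ((L : ℝ) - a)) f := by
    have hψ := psiConvex_holds 0 le_rfl (by norm_num)
    refine ⟨convex_Icc _ _, ?_⟩
    intro x hx y hy p q hp hq hpq
    have hxU : cL * x ∈ {k : ℝ | 0 < k ∧ k < 2 * Real.pi ∧ (0 : ℝ) < Real.sin (k / 2) ^ 2} := by
      obtain ⟨h0, h2⟩ := hrange x hx
      exact ⟨h0, h2, pow_pos (Real.sin_pos_of_pos_of_lt_pi (by linarith) (by linarith)) 2⟩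
    have hyU : cL * y ∈ {k : ℝ | 0 < k ∧ k < 2 * Real.pi ∧ (0 : ℝ) < Real.sin (k / 2) ^ 2} := by
      obtain ⟨h0, h2⟩ := hrange y hy
      exact ⟨h0, h2, pow_pos (Real.sin_pos_of_pos_of_lt_pi (by linarith) (by linarith)) 2⟩
    have h := hψ.2 hxU hyU hp hq hpq
    simp only [hf, smul_eq_mul] at h ⊢
    rw [show cL * (p * x + q * y) = p * (cL * x) + q * (cL * y) by ring]
    exact h
  -- apply the one-sided trapezoidal Euler–Maclaurin lemma
  have hAB : (a : ℤ) < (L : ℤ) - a := by omega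
  have hT := trapezoidConvex_holds f f' (a : ℤ) ((L : ℤ) - a) hAB
    (by push_cast; exact hconv) (by push_cast; exact hderiv) (by push_cast; exact hcont')
  push_cast at hT
  -- identify the pieces
  have hsum : (∑ m ∈ Finset.Icc (a : ℤ) ((L : ℤ) - a), f m)
      = ∑ m ∈ Finset.Icc (a : ℤ) ((L : ℤ) - a), psiRow 0 (2 * Real.pi * (m : ℝ) / L) := by
    refine Finset.sum_congr rfl (fun m _ => ?_)
    have e : cL * (m : ℝ) = 2 * Real.pi * (m : ℝ) / L := by rw [hcL]; ring
    simp only [hf, e]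
  have hcLa : cL * (a : ℝ) = 2 * Real.pi * a / L := by rw [hcL]; ring
  have hfa : f a = psiRow 0 (2 * Real.pi * a / L) := by simp only [hf, hcLa]
  have hfb : f ((L : ℝ) - a) = psiRow 0 (2 * Real.pi * a / L) := by
    simp only [hf]
    rw [show cL * ((L : ℝ) - a) = 2 * Real.pi - 2 * Real.pi * a / L by rw [hcL]; field_simp]
    exact psiRow_zero_reflect _
  have hga : f' a = cL * g (2 * Real.pi * a / L) := by simp only [hf', hcLa]
  have hgb : f' ((L : ℝ) - a) = -(cL * g (2 * Real.pi * a / L)) := by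
    simp only [hf']
    rw [show cL * ((L : ℝ) - a) = 2 * Real.pi - 2 * Real.pi * a / L by rw [hcL]; field_simp]
    simp only [hg]
    rw [deriv_profile_reflect]
    ring
  -- the integral
  have hu0 : 0 < 2 * Real.pi * a / L := by positivity
  have huπ : 2 * Real.pi * a / L ≤ Real.pi := by
    rw [div_le_iff₀ hL0]; nlinarith
  have hint : (∫ x in (a : ℝ)..((L : ℝ) - a), f x)
      = (L : ℝ) / (4 * Real.pi) * Real.log ((1 + Real.sqrt (1 - Real.sin (Real.pi * a / L) ^ 4))
          / Real.sin (Real.pi * a / L) ^ 2) := by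
    simp only [hf]
    rw [intervalIntegral.integral_comp_mul_left (fun k => psiRow 0 k) hcL0.ne',
      show cL * (a : ℝ) = 2 * Real.pi * a / L by rw [hcL]; ring,
      show cL * ((L : ℝ) - a) = 2 * Real.pi - 2 * Real.pi * a / L by rw [hcL]; field_simp,
      integral_psiRow_zero_symm _ hu0 huπ,
      show 2 * Real.pi * (a : ℝ) / L / 2 = Real.pi * a / L by ring, hcL, smul_eq_mul]
    field_simp
    ring
  rw [hsum, hint, hfa, hfb, hga, hgb] at hT
  have e2 : (psiRow 0 (2 * Real.pi * a / L) + psiRow 0 (2 * Real.pi * a / L)) / 2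
      = psiRow 0 (2 * Real.pi * a / L) := by ring
  rw [e2] at hT
  refine ⟨hT.1, hT.2.trans (le_of_eq ?_)⟩
  simp only [hg, hcL]
  rw [show 2 * Real.pi * (a : ℝ) / L / 2 = Real.pi * a / L by ring]
  field_simp
  ring

end CapacityConst

end Summit.HubbardSuperconductivity.HubbardSuperconductivity.Theorems.AnisotropyChord.Transfer.Fibre3

end
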